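import Summits.AtomisticToContinuum.Crystallization.Theses.NashClassCertificates
import Summits.AtomisticToContinuum.Crystallization.Theorems.ChargedEnergyGap.Negative.BlocksBound

/-!
# Crux `NashTwoShellGap` (stmt-AtomisticToContinuum-16826), line `bulk_dilute`: the bulk stub in
# `e*`-FREE IMPROVEMENT FORM

The load-bearing stub of line `bulk_dilute` is the flat bad-phase gap on the torus,
`stub_badPhaseGap : ∀ β₀ > 0, ∃ γ > 0, ∀ P` (periodic, `1/3`-separated points, bad motif fraction `≥ β₀`),
`e* + γ ≤ e(P)`, with `e* = ⨅_Q e(Q)` the UNKNOWN periodic infimum (certified in tree only as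
`−2³²/12 ≤ e* ≤ −0.711`).  This file removes `e*` from the statement (registered sub-goal
`stub_badPhaseGapImprovementForm`): the stub is EQUIVALENT to

  `∀ β₀ > 0, ∃ γ > 0, ∀ P` (same hypotheses), `∃ Q periodic, e(Q) + γ ≤ e(P)`

— every bad-dense periodic configuration is BEATEN BY A UNIFORM MARGIN by some periodic configuration
(which may depend on `P`: a repaired / re-crystallised competitor, not necessarily a minimiser).
`→`: `e* + γ ≤ e(P)` and a `γ/2`-minimiser `Q` of the infimum (`exists_lt_of_ciInf_lt`) give
`e(Q) + γ/2 ≤ e(P)`; `←`: `e* ≤ e(Q)` (`ChargedEnergyGapNegative.eStar_le`).  Reading for provers: a proof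
of the bulk stub is exactly a uniform IMPROVEMENT (surgery) theorem for bad-dense periodic matter; no
value of `e*` is ever needed, but the margin must be uniform in the cell size.  No definitions; all
`[folklore]`.
-/

noncomputable section

namespace Summit.AtomisticToContinuum.Crystallization.Theorems.NashTwoShellGapBadPhaseGapImprovementForm

open scoped BigOperators Classical
open Literature.MathematicalPhysics.StatisticalMechanics Literature.Geometry.DiscreteGeometry
open Summit.AtomisticToContinuum.Crystallization.Theorems.ChargedEnergyGapNegative

/-- **Improvement ⇒ gap against `e*`**: if some periodic `Q` has `e(Q) + γ ≤ e(P)` then `e* + γ ≤ e(P)`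
(`e* ≤ e(Q)`). [folklore] -/
theorem eStar_add_le_of_improvement {γ : ℝ} {P : PeriodicConfiguration 3}
    (h : ∃ Q : PeriodicConfiguration 3, Q.energyPerParticle lennardJones + γ ≤ P.energyPerParticle lennardJones) :
    eStar + γ ≤ P.energyPerParticle lennardJones := by
  obtain ⟨Q, hQ⟩ := h
  linarith [eStar_le Q]

/-- **Gap against `e*` ⇒ improvement with half the margin**: if `e* + γ ≤ e(P)` with `γ > 0` then some
periodic `Q` has `e(Q) + γ/2 ≤ e(P)` (a `γ/2`-minimiser of the infimum). [folklore] -/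
theorem improvement_of_eStar_add_le {γ : ℝ} (hγ : 0 < γ) {P : PeriodicConfiguration 3}
    (h : eStar + γ ≤ P.energyPerParticle lennardJones) :
    ∃ Q : PeriodicConfiguration 3, Q.energyPerParticle lennardJones + γ / 2 ≤ P.energyPerParticle lennardJones := by
  have hlt : eStar < eStar + γ / 2 := by linarith
  obtain ⟨Q, hQ⟩ := exists_lt_of_ciInf_lt hlt
  refine ⟨Q, ?_⟩
  have hQ' : Q.energyPerParticle lennardJones < eStar + γ / 2 := hQ
  linarith

/-- **Registered sub-goal `stub_badPhaseGapImprovementForm`** — the bulk stub of line `bulk_dilute` is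
equivalent to its `e*`-free improvement form: every periodic configuration with `1/3`-separated points and
bad motif fraction `≥ β₀` is beaten, by a margin `γ(β₀) > 0` uniform in the configuration, by SOME periodic
configuration. [folklore] -/
theorem stub_badPhaseGapImprovementForm : (∀ β₀ : ℝ, 0 < β₀ → ∃ γ : ℝ, 0 < γ ∧ ∀ P : Literature.MathematicalPhysics.StatisticalMechanics.PeriodicConfiguration 3, (∀ u ∈ P.points, ∀ v ∈ P.points, u ≠ v → (1 / 3 : ℝ) ≤ dist u v) → β₀ * (P.motif.card : ℝ) ≤ ((P.motif.filter fun y => ¬ Literature.Geometry.DiscreteGeometry.IsTwoShellGoodSet (1 / 20) (47 / 50) 1 P.points y).card : ℝ) → (⨅ Q : Literature.MathematicalPhysics.StatisticalMechanics.PeriodicConfiguration 3, Q.energyPerParticle Literature.MathematicalPhysics.StatisticalMechanics.lennardJones) + γ ≤ P.energyPerParticle Literature.MathematicalPhysics.StatisticalMechanics.lennardJones) ↔ (∀ β₀ : ℝ, 0 < β₀ → ∃ γ : ℝ, 0 < γ ∧ ∀ P : Literature.MathematicalPhysics.StatisticalMechanics.PeriodicConfiguration 3, (∀ u ∈ P.points,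 ∀ v ∈ P.points, u ≠ v → (1 / 3 : ℝ) ≤ dist u v) → β₀ * (P.motif.card : ℝ) ≤ ((P.motif.filter fun y => ¬ Literature.Geometry.DiscreteGeometry.IsTwoShellGoodSet (1 / 20) (47 / 50) 1 P.points y).card : ℝ) → ∃ Q : Literature.MathematicalPhysics.StatisticalMechanics.PeriodicConfiguration 3, Q.energyPerParticle Literature.MathematicalPhysics.StatisticalMechanics.lennardJones + γ ≤ P.energyPerParticle Literature.MathematicalPhysics.StatisticalMechanics.lennardJones) := by
  constructor
  · intro h β₀ hβ₀
    obtain ⟨γ, hγ, hG⟩ := h β₀ hβ₀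
    refine ⟨γ / 2, half_pos hγ, fun P hsep hfrac => ?_⟩
    exact improvement_of_eStar_add_le hγ (hG P hsep hfrac)
  · intro h β₀ hβ₀
    obtain ⟨γ, hγ, hG⟩ := h β₀ hβ₀
    refine ⟨γ, hγ, fun P hsep hfrac => ?_⟩
    exact eStar_add_le_of_improvement (hG P hsep hfrac)

end Summit.AtomisticToContinuum.Crystallization.Theorems.NashTwoShellGapBadPhaseGapImprovementForm

end
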